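import Literature.Computability.Complexity.RandomKSatThresholdReduction
import Literature.Computability.Complexity.RandomKSatWeights
import Literature.Computability.Complexity.RandomKSatBalancedFirstMoment
import Literature.Computability.Complexity.RandomKSatDomination
import Literature.Combinatorics.BinomialLaplaceBound
import Mathlib.Analysis.SpecificLimits.Normed
import HarnessLib

/-!
# Achlioptas–Peres 2004: uniformly positive satisfiability below `2^k log 2 - (k+1) log 2/2 - 1 - o(1)`,
# and Theorem 2 from a sharp-threshold sequence

The assembly of the uniformly-positive-probability theorem behind `AchlioptasPeres2004_threshold_lower_bound`
(`RandomKSatThreshold.lean`; D. Achlioptas, Y. Peres, J. Amer. Math. Soc. 17 (2004), Thm. 2;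
arXiv:cs/0305009) from the pieces proved in the sibling files:

* the second-moment inequality and the moment identities (`RandomKSatWeights.lean`),
  AP Lemma 7 in positive form (`RandomKSatBalancedFirstMoment.lean`),
* the Laplace bound (`Literature.Combinatorics.sum_choose_mul_pow_le_two_pow`, AP Lemma 2),
* AP Lemma 8 in quantitative form (`RandomKSat.domination`, `RandomKSatDomination.lean`),
* the reduction of Theorem 2 to uniform positivity plus a sharp threshold sequence
  (`achlioptasPeres2004_threshold_lower_bound_of_uniformlyPos`, `RandomKSatThresholdReduction.lean`).

## Results (all proved)

* `litArraySatProb_ge_of_bounds` — the counting chain AP (51)+(50)+Lemma 2+Lemma 1: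
  `Pr[F_k(n,m) sat] ≥ c₇²/C` from `E X₊ ≥ c₇ E X`, the pair-sum bound and the Laplace bound;
* `achlioptasPeres2004_uniformlyPos` — **AP's theorem before Friedgut** (arXiv p. 16: "we can
  conclude that `E[X₊²] < C E[X₊]²` … Lemma 1 and Corollary 1 then imply `r_k ≥ r`"): for every
  `k ≥ 1024` and every `r < ρ_k = L_k - 2δ_k` (`L_k = 2^k log 2 - (k+1) log 2/2 - 1`,
  `δ_k = 15k²/2^k + E_k → 0`), `F_k(n, ⌊rn⌋)` is satisfiable with probability `≥ c(k,r) > 0` for all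
  large `n` (uniformly positive probability) — UNCONDITIONAL;
* `tendsto_two_mul_delta` — `L_k - ρ_k = 2δ_k → 0`;
* `achlioptasPeres2004_threshold_lower_bound_of_sharpThreshold` — **Theorem 2 of AP2004 follows
  from the existence of a sharp satisfiability threshold sequence for every `k ≥ 2`** (Friedgut
  1999, Thm. 1.3 = AP Thm. 3; proved for `k ≥ 3` in `RandomKSatSharpThreshold.lean`, which is all
  the discharge `AchlioptasPeres2004_threshold_lower_bound_holds` of `RandomKSatThresholdProofs.lean`
  needs).
-/

noncomputable section

namespace Literature.Computability.Complexity

open Finset Filter Real Literature.Probability.LatticeModels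
open scoped Classical Topology

namespace RandomKSat

variable {n k m : ℕ}

/-- `min (a^m) (b^m) ≤ (min a b)^m`. [folklore] -/
theorem min_pow_le_pow_min (a b : ℝ) (m : ℕ) :
    min (a ^ m) (b ^ m) ≤ (min a b) ^ m := by
  rcases le_total a b with h | h
  · rw [min_eq_left h]; exact min_le_left _ _
  · rw [min_eq_right h]; exact min_le_right _ _

/-- **The counting chain** (AP Lemma 1 + (50)–(51) + Lemma 2): in the literal-array model with
`n ≥ 1`, `λ₀ = 1 - ε₀`, `λ₁ = 1 - ε₀/2`, if `Σ_Φ X₊ ≥ c₇ Σ_Φ X` and the Laplace bound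
`Σ_z C(n,z) q_z^m ≤ C 2^n` holds for `q_z = min(F_{λ₀}(z/n), (λ₀/λ₁)^k F_{λ₁}(z/n))/F_{λ₀}(1/2)`,
then `Pr[F_k(n,m) satisfiable] ≥ c₇²/C`. [cite: AchlioptasPeres2004, §7 (50)–(51) p. 15 and Lemma 1 p. 3] -/
theorem litArraySatProb_ge_of_bounds (hn : 1 ≤ n) {ε₀ : ℝ} (hε0 : 0 < ε₀) (hε01 : ε₀ < 1)
    (hF0h : 0 < pairPoly k (1 - ε₀) (1 / 2)) {c₇ : ℝ} (hc₇ : 0 < c₇)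
    (hbalanced : c₇ * ∑ Φ : Fin m → Fin k → Fin n × Bool, weightedCount (1 - ε₀) Φ ≤
      ∑ Φ : Fin m → Fin k → Fin n × Bool, balancedCount (1 - ε₀) Φ)
    {C : ℝ} (hC : 0 < C)
    (hLap : ∑ z ∈ range (n + 1), (n.choose z : ℝ) *
        (min (pairPoly k (1 - ε₀) (z / n))
            (((1 - ε₀) / (1 - ε₀ / 2)) ^ k * pairPoly k (1 - ε₀ / 2) (z / n)) /
          pairPoly k (1 - ε₀) (1 / 2)) ^ m ≤ C * 2 ^ n) :
    c₇ ^ 2 / C ≤ litArraySatProb k n m := by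
  have hnpos : (0 : ℝ) < n := by exact_mod_cast hn
  have hl0 : 0 ≤ 1 - ε₀ := by linarith
  have hl1 : 0 < 1 - ε₀ / 2 := by linarith
  have hρ0 : 0 ≤ ((1 - ε₀) / (1 - ε₀ / 2)) := div_nonneg hl0 hl1.le
  set F0h := pairPoly k (1 - ε₀) (1 / 2) with hF0hdef
  set Ssum := ∑ Φ : Fin m → Fin k → Fin n × Bool, weightedCount (1 - ε₀) Φ with hSsum
  set Splus := ∑ Φ : Fin m → Fin k → Fin n × Bool, balancedCount (1 - ε₀) Φ with hSplus
  set Q := ∑ Φ : Fin m → Fin k → Fin n × Bool, balancedCount (1 - ε₀) Φ ^ 2 with hQ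
  set Nsat : ℝ := ((univ.filter fun Φ : Fin m → Fin k → Fin n × Bool => LitArraySat Φ).card : ℝ)
    with hNsat
  set q : ℕ → ℝ := fun z => min (pairPoly k (1 - ε₀) (z / n))
      (((1 - ε₀) / (1 - ε₀ / 2)) ^ k * pairPoly k (1 - ε₀ / 2) (z / n)) / F0h with hq
  -- (1) Cauchy–Schwarz
  have h1 : Splus ^ 2 ≤ Nsat * Q := sq_sum_balancedCount_le hl0
  -- (2) `c₇ S ≤ S₊`, `S ≥ 0`
  have hS0 : 0 ≤ Ssum := Finset.sum_nonneg fun Φ _ => weightedCount_nonneg hl0 Φ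
  have h2 : (c₇ * Ssum) ^ 2 ≤ Splus ^ 2 := pow_le_pow_left₀ (by positivity) hbalanced 2
  -- (3) the first moment
  have h3 : Ssum = 2 ^ n * ((n : ℝ) ^ k * ((1 + (1 - ε₀)) ^ k - 1)) ^ m := sum_weightedCount _
  have hU : ((1 + (1 - ε₀)) ^ k - 1) ^ 2 = 2 ^ k * F0h := (pairPoly_half' k (1 - ε₀)).symm
  -- (4) the pair sum
  have h4 : Q ≤ 2 ^ n * ∑ z ∈ range (n + 1), (n.choose z : ℝ) *
      (((n : ℝ) ^ k) ^ m * F0h ^ m * q z ^ m) := by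
    have hpair := sum_balancedCount_sq_le (n := n) (k := k) (m := m) hl0
      (show 1 - ε₀ ≤ 1 - ε₀ / 2 by linarith) hl1
    -- rewrite the clause sums as `n^k F(z/n)` and bound the `min`
    have hpt : ∀ σ τ : Fin n → Bool,
        min ((∑ c : Fin k → Fin n × Bool, clauseWeight (1 - ε₀) σ c * clauseWeight (1 - ε₀) τ c) ^ m)
          (((1 - ε₀) / (1 - ε₀ / 2)) ^ (k * m) *
            (∑ c : Fin k → Fin n × Bool, clauseWeight (1 - ε₀ / 2) σ c * clauseWeight (1 - ε₀ / 2) τ c) ^ m) ≤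
        ((n : ℝ) ^ k) ^ m * F0h ^ m * q (overlap σ τ) ^ m := by
      intro σ τ
      rw [sum_clauseWeight_mul_eq_pairPoly hn, sum_clauseWeight_mul_eq_pairPoly hn, pow_mul, ← mul_pow]
      refine (min_pow_le_pow_min _ _ m).trans (le_of_eq ?_)
      rw [← mul_pow, ← mul_pow]
      congr 1
      have eq : F0h * q (overlap σ τ) = min (pairPoly k (1 - ε₀) (overlap σ τ / n))
          (((1 - ε₀) / (1 - ε₀ / 2)) ^ k * pairPoly k (1 - ε₀ / 2) (overlap σ τ / n)) := by
        simp only [hq]; rw [mul_div_cancel₀ _ hF0h.ne']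
      rw [mul_assoc, eq, mul_min_of_nonneg _ _ (by positivity : (0 : ℝ) ≤ (n : ℝ) ^ k)]
      congr 1; ring
    calc Q ≤ _ := hpair
      _ ≤ ∑ σ : Fin n → Bool, ∑ τ : Fin n → Bool, ((n : ℝ) ^ k) ^ m * F0h ^ m * q (overlap σ τ) ^ m :=
          Finset.sum_le_sum fun σ _ => Finset.sum_le_sum fun τ _ => hpt σ τ
      _ = _ := sum_sum_overlap (fun z => ((n : ℝ) ^ k) ^ m * F0h ^ m * q z ^ m)
  -- (5) the Laplace bound
  have h5 : ∑ z ∈ range (n + 1), (n.choose z : ℝ) * (((n : ℝ) ^ k) ^ m * F0h ^ m * q z ^ m) ≤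
      ((n : ℝ) ^ k) ^ m * F0h ^ m * (C * 2 ^ n) := by
    have e : ∑ z ∈ range (n + 1), (n.choose z : ℝ) * (((n : ℝ) ^ k) ^ m * F0h ^ m * q z ^ m) =
        ((n : ℝ) ^ k) ^ m * F0h ^ m * ∑ z ∈ range (n + 1), (n.choose z : ℝ) * q z ^ m := by
      rw [Finset.mul_sum]; refine Finset.sum_congr rfl fun z _ => ?_; ring
    rw [e]
    exact mul_le_mul_of_nonneg_left hLap (by positivity)
  -- (6) combine
  have hcard : (Fintype.card (Fin m → Fin k → Fin n × Bool) : ℝ) = 2 ^ (k * m) * ((n : ℝ) ^ k) ^ m := by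
    simp only [Fintype.card_fun, Fintype.card_fin, Fintype.card_prod, Fintype.card_bool]
    push_cast
    ring
  have hkey : c₇ ^ 2 * (2 ^ (k * m) * ((n : ℝ) ^ k) ^ m) ≤ C * Nsat := by
    -- `c₇² S² ≤ Nsat Q ≤ Nsat · 2^n (n^k)^m F0h^m C 2^n` and `S² = 4^n (n^k)^{2m} 2^{km} F0h^m`
    have hchain : (c₇ * Ssum) ^ 2 ≤ Nsat * (2 ^ n * (((n : ℝ) ^ k) ^ m * F0h ^ m * (C * 2 ^ n))) := by
      have hN0 : 0 ≤ Nsat := Nat.cast_nonneg _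
      calc (c₇ * Ssum) ^ 2 ≤ Splus ^ 2 := h2
        _ ≤ Nsat * Q := h1
        _ ≤ Nsat * (2 ^ n * ∑ z ∈ range (n + 1), (n.choose z : ℝ) *
              (((n : ℝ) ^ k) ^ m * F0h ^ m * q z ^ m)) := mul_le_mul_of_nonneg_left h4 hN0
        _ ≤ _ := mul_le_mul_of_nonneg_left (mul_le_mul_of_nonneg_left h5 (by positivity)) hN0
    set A : ℝ := (1 + (1 - ε₀)) ^ k - 1 with hA
    have hAm : (A ^ m) ^ 2 = 2 ^ (k * m) * F0h ^ m := by
      rw [← pow_mul, show m * 2 = 2 * m from mul_comm _ _, pow_mul, hU, mul_pow, ← pow_mul]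
    have hS2 : (c₇ * Ssum) ^ 2 =
        (c₇ ^ 2 * (2 ^ (k * m) * ((n : ℝ) ^ k) ^ m)) * ((2 ^ n) ^ 2 * ((n : ℝ) ^ k) ^ m * F0h ^ m) := by
      rw [h3]
      calc (c₇ * (2 ^ n * ((n : ℝ) ^ k * A) ^ m)) ^ 2
          = c₇ ^ 2 * (2 ^ n) ^ 2 * (((n : ℝ) ^ k) ^ m) ^ 2 * ((A ^ m) ^ 2) := by ring
        _ = _ := by rw [hAm]; ring
    have e6 : Nsat * (2 ^ n * (((n : ℝ) ^ k) ^ m * F0h ^ m * (C * 2 ^ n))) =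
        (C * Nsat) * ((2 ^ n) ^ 2 * ((n : ℝ) ^ k) ^ m * F0h ^ m) := by ring
    rw [hS2, e6] at hchain
    have hpos : 0 < ((2 : ℝ) ^ n) ^ 2 * ((n : ℝ) ^ k) ^ m * F0h ^ m := by positivity
    exact le_of_mul_le_mul_right hchain hpos
  unfold litArraySatProb
  rw [hcard, div_le_div_iff₀ hC (by positivity)]
  calc c₇ ^ 2 * (2 ^ (k * m) * ((n : ℝ) ^ k) ^ m) ≤ C * Nsat := hkey
    _ = Nsat * C := mul_comm _ _

end RandomKSat

open RandomKSat

/-- **Achlioptas–Peres 2004, the theorem behind Theorem 2 before Friedgut's theorem is invoked**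
(arXiv:cs/0305009 p. 16 with Lemma 8: `E[X₊²] < C E[X₊]²`, hence by Lemma 1
`Pr[F_k(n, rn) sat] > 1/C'`): for every `k ≥ 1024` and every
`r < ρ_k := (2^k log 2 - (k+1) log 2/2 - 1) - 2δ_k`, `δ_k = 15k²/2^k + (k+3)/2^k + 32k²(50/81)^k
+ 32k(5/9)^k`, there is `c > 0` with `Pr[F_k(n, ⌊rn⌋) satisfiable] ≥ c` for all large `n`
(uniformly positive probability). UNCONDITIONAL (no named facts).
[cite: AchlioptasPeres2004, §7 p. 16 (E[X₊²] < C E[X₊]²) with Lemma 1 p. 3] -/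
theorem achlioptasPeres2004_uniformlyPos {k : ℕ} (hk : 1024 ≤ k) {r : ℝ}
    (hr : r < (2 ^ k * Real.log 2 - (k + 1) * Real.log 2 / 2 - 1) -
      2 * (15 * k ^ 2 / 2 ^ k + ((k + 3) / 2 ^ k + 32 * k ^ 2 * (50 / 81) ^ k + 32 * k * (5 / 9) ^ k))) :
    ∃ c : ℝ, 0 < c ∧ ∀ᶠ n : ℕ in atTop, c ≤ litArraySatProb k n ⌊r * n⌋₊ := by
  by_cases hr0 : r < 0
  · refine ⟨1, one_pos, Eventually.of_forall fun n => ?_⟩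
    have : ⌊r * (n : ℝ)⌋₊ = 0 :=
      Nat.floor_of_nonpos (mul_nonpos_of_nonpos_of_nonneg hr0.le (Nat.cast_nonneg n))
    rw [this, litArraySatProb_zero_right]
  push Not at hr0
  obtain ⟨ε₀, hε0, hε01, _, hbal', _, _, hF0h, κ, hκ0, hdom⟩ := domination hk
  obtain ⟨c₇, hc₇, hbalanced⟩ :=
    exists_sum_balancedCount_ge (k := k) (by omega) (lam := 1 - ε₀) (by linarith) hbal'
  obtain ⟨C, hC, hLap⟩ := Literature.Combinatorics.sum_choose_mul_pow_le_two_pow hκ0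
  refine ⟨c₇ ^ 2 / C, by positivity, ?_⟩
  filter_upwards [eventually_ge_atTop 1] with n hn
  have hnpos : (0 : ℝ) < n := by exact_mod_cast hn
  apply litArraySatProb_ge_of_bounds hn hε0 hε01 hF0h hc₇ (hbalanced n _ hn) hC
  apply hLap n ⌊r * n⌋₊ r hr0 (Nat.floor_le (by positivity))
  intro z hz
  have hz1 : (z : ℝ) / n ≤ 1 := by rw [div_le_one hnpos]; exact_mod_cast hz
  obtain ⟨h0, h1⟩ := hdom r hr0 hr.le ((z : ℝ) / n) (by positivity) hz1
  refine ⟨h0, ?_⟩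
  have e : 2 * ((z : ℝ) / n) - 1 = (2 * z - n) / n := by field_simp
  rw [e] at h1
  exact h1

/-- `L_k - ρ_k = 2δ_k → 0`. [folklore] -/
theorem tendsto_two_mul_delta :
    Tendsto (fun k : ℕ => (2 ^ k * Real.log 2 - ((k : ℝ) + 1) * Real.log 2 / 2 - 1) -
      ((2 ^ k * Real.log 2 - ((k : ℝ) + 1) * Real.log 2 / 2 - 1) -
        2 * (15 * (k : ℝ) ^ 2 / 2 ^ k + (((k : ℝ) + 3) / 2 ^ k + 32 * (k : ℝ) ^ 2 * (50 / 81) ^ k +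
          32 * (k : ℝ) * (5 / 9) ^ k)))) atTop (𝓝 0) := by
  have T1 := tendsto_pow_const_div_const_pow_of_one_lt 2 (one_lt_two : (1 : ℝ) < 2)
  have T2 := tendsto_pow_const_div_const_pow_of_one_lt 1 (one_lt_two : (1 : ℝ) < 2)
  have T3 : Tendsto (fun k : ℕ => (3 : ℝ) / 2 ^ k) atTop (𝓝 0) :=
    tendsto_const_nhds.div_atTop (tendsto_pow_atTop_atTop_of_one_lt one_lt_two)
  have T4 := tendsto_pow_const_mul_const_pow_of_abs_lt_one 2
    (show |(50 : ℝ) / 81| < 1 by rw [abs_of_pos (by norm_num)]; norm_num)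
  have T5 := tendsto_pow_const_mul_const_pow_of_abs_lt_one 1
    (show |(5 : ℝ) / 9| < 1 by rw [abs_of_pos (by norm_num)]; norm_num)
  have h := ((T1.const_mul 15).add ((T2.add T3).add ((T4.const_mul 32).add (T5.const_mul 32)))).const_mul 2
  simp only [mul_zero, add_zero] at h
  refine h.congr fun k => ?_
  simp only [pow_one]
  ring

/-- **Achlioptas–Peres 2004, Theorem 2, from a sharp threshold sequence.** If for every `k ≥ 2`
random `k`-SAT has a sharp satisfiability threshold sequence `r_k(n)`
(`Pr[F_k(n, ⌊(1-ε) r_k(n) n⌋) sat] → 1` and `Pr[F_k(n, ⌊(1+ε) r_k(n) n⌋) sat] → 0` for all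
`ε > 0`: Friedgut 1999, Thm. 1.3 = AP Thm. 3, proved for `k ≥ 3` in `RandomKSatSharpThreshold.lean`),
then `AchlioptasPeres2004_threshold_lower_bound` holds, with the
explicit choice `δ_k = 2(15k²/2^k + (k+3)/2^k + 32k²(50/81)^k + 32k(5/9)^k)` for `k ≥ 1024`
(`achlioptasPeres2004_uniformlyPos` + AP Corollary 1 via
`achlioptasPeres2004_threshold_lower_bound_of_uniformlyPos`).
[cite: AchlioptasPeres2004, Thm. 2 (arXiv:cs/0305009 p. 2), proof pp. 15–16] -/
theorem achlioptasPeres2004_threshold_lower_bound_of_sharpThreshold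
    (hF : ∀ k : ℕ, 2 ≤ k → ∃ rk : ℕ → ℝ, ∀ ε : ℝ, 0 < ε →
      Tendsto (fun n : ℕ => litArraySatProb k n ⌊(1 - ε) * rk n * n⌋₊) atTop (𝓝 1) ∧
      Tendsto (fun n : ℕ => litArraySatProb k n ⌊(1 + ε) * rk n * n⌋₊) atTop (𝓝 0)) :
    AchlioptasPeres2004_threshold_lower_bound :=
  achlioptasPeres2004_threshold_lower_bound_of_uniformlyPos hF
    (fun k => (2 ^ k * Real.log 2 - ((k : ℝ) + 1) * Real.log 2 / 2 - 1) -
      2 * (15 * (k : ℝ) ^ 2 / 2 ^ k + (((k : ℝ) + 3) / 2 ^ k + 32 * (k : ℝ) ^ 2 * (50 / 81) ^ k +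
        32 * (k : ℝ) * (5 / 9) ^ k)))
    1024 (fun _ hk _ hr => achlioptasPeres2004_uniformlyPos hk hr) tendsto_two_mul_delta

end Literature.Computability.Complexity

end
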